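import Mathlib
import Summits.ValiantsHypothesis.ValiantsHypothesis.Theorems.NewtonUnitEquationsDissociatedUniformTotalsLaw
import Summits.ValiantsHypothesis.ValiantsHypothesis.Theorems.NewtonUnitEquationsDissociatedUniformTotalsLawChartTops
import Summits.ValiantsHypothesis.ValiantsHypothesis.Theorems.NewtonUnitEquationsDissociatedUniformTotalsLawChartLevels
import Summits.ValiantsHypothesis.ValiantsHypothesis.Theorems.NewtonUnitEquationsDissociatedUniformTotalsLawChartLevelsTopSets
import Summits.ValiantsHypothesis.ValiantsHypothesis.Theorems.NewtonUnitEquationsDissociatedUniformTotalsLawChartLevelsCount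
import Summits.ValiantsHypothesis.ValiantsHypothesis.Theorems.NewtonUnitEquationsDissociatedUniformTotalsLawChartLevelsPairs
import Summits.ValiantsHypothesis.ValiantsHypothesis.Theorems.NewtonUnitEquationsDissociatedUniformTotalsLawTopKCells
import Summits.ValiantsHypothesis.ValiantsHypothesis.Theorems.NewtonUnitEquationsDissociatedUniformTotalsLawFibreDepthSets
import Literature.Computability.AlgebraicComplexity.NewtonPolygonTauProductBounds
import HarnessLib

/-!
# Crux `NewtonUnitEquations.DissociatedUniform` (stmt-ValiantsHypothesis-5905): totals law — DEPTH PAIRS of bounded order are few (threshold lemma + cells)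

Second tool file for the AVERAGE UNION LAW (companion `…TotalsLawAverageUnion`; memo `Cruxes/DissociatedUniform/NOTES-t1g12.md` §2).
With `aboveFib a b σ t v` the set of fibres of `A + B` above the point `v` at the chart weight `(σ, t)` (`…TotalsLawFibreDepthSets`),
a DEPTH PAIR of order `≤ j` off a time set `T` is a pair `(v, aboveFib σ t v)` with `v ∈ A + B`, `t ∉ T` and `#aboveFib ≤ j`.
PROVED here (arbitrary `a b : G → ℝ²`, no injectivity, no general position):
* `card_thresholdSets_le` — THRESHOLD LEMMA: for a finite `Q` and a point `v`, the sets `{w ∈ Q : w above v at time t}`, `t`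
  ranging over any set of times, number at most `#Q + 1` (every `w` crosses `v` at most once, upwards if its slope is larger,
  downwards if smaller; the potential `#{up-slope members} + #{down-slope non-members}` is injective on the realised sets);
* **`card_depthPairs_le`** — if `T` contains the low-event times of order `< j+1` of `A = a(G)` and of `B = b(G)`
  (`…ChartLevels.lowEvents`), the depth pairs of order `≤ j` off `T` number at most `(#T + 1)·(j+1)²·((j+1)²+1)`: in each cell
  between consecutive times of `T` the set `topSum_j` is one set `Q` of `≤ (j+1)²` points (`…TopKCells`), every depth pair of the
  cell has `v ∈ Q` and its fibre set determined by `{w ∈ Q : w above v}` (`aboveFib_eq_biUnion_topSum`), and the threshold lemma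
  bounds these;
* `lowTimes`, `card_lowTimes_le` (`≤ 32|G|(j+1)` by `…ChartLevelsCount.card_lowEvents_le`, Clarkson–Shor) and
  **`card_depthPairs_le_poly`**: off any `T ⊇ lowTimes_j` there are at most `(32|G|(j+1)+1)(j+1)²((j+1)²+1)` depth pairs of
  order `≤ j` — polynomial in `j`, LINEAR in `|G|`, which is what makes the level-weighted subset count of the companion converge.
Honest label: tool lemmas; `UnionTotalsLaw`, `UnionVertBound`, `TotalsLawThree` remain OPEN; nothing here bears on VP ≠ VNP.
[folklore: levels in arrangements of lines; threshold functions]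
-/

set_option linter.dupNamespace false -- `ValiantsHypothesis.ValiantsHypothesis` (summit = problem) in every name

open scoped BigOperators Pointwise
open Matrix Finset

namespace Summit.ValiantsHypothesis.ValiantsHypothesis.Theorems.NewtonUnitEquationsDissociatedUniform

namespace TotalsLaw

open Literature.Computability.AlgebraicComplexity.KPTT.PlanarMinkowski

/-! ### The threshold lemma: `{w ∈ Q : w above v at time t}` takes at most `#Q + 1` values -/

section Threshold

open Classical in
/-- The family of "above sets" `{w ∈ Q : ⟨(σ,t), v⟩ < ⟨(σ,t), w⟩}` realised at the times of `I`. -/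
noncomputable def thresholdSets (σ : ℝ) (Q : Finset (Fin 2 → ℝ)) (v : Fin 2 → ℝ) (I : Set ℝ) : Finset (Finset (Fin 2 → ℝ)) :=
  Q.powerset.filter fun X => ∃ t ∈ I, X = Q.filter fun w => ![σ, t] ⬝ᵥ v < ![σ, t] ⬝ᵥ w

/-- The score difference of `w` over `v` along the chart is affine in `t` with slope `w 1 - v 1`. [folklore] -/
theorem chart_sub_eq (σ t : ℝ) (v w : Fin 2 → ℝ) :
    ![σ, t] ⬝ᵥ w - ![σ, t] ⬝ᵥ v = σ * (w 0 - v 0) + t * (w 1 - v 1) := by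
  rw [chart_dotProduct, chart_dotProduct]; ring

/-- A point of larger slope that is above `v` at time `t` stays above at every later time. [folklore] -/
theorem above_mono_up {σ t t' : ℝ} {v w : Fin 2 → ℝ} (hs : v 1 ≤ w 1) (htt : t ≤ t')
    (h : ![σ, t] ⬝ᵥ v < ![σ, t] ⬝ᵥ w) : ![σ, t'] ⬝ᵥ v < ![σ, t'] ⬝ᵥ w := by
  have e1 := chart_sub_eq σ t v w
  have e2 := chart_sub_eq σ t' v w
  nlinarith [mul_le_mul_of_nonneg_right htt (sub_nonneg.2 hs)]

/-- A point of smaller slope that is above `v` at time `t'` was above at every earlier time. [folklore] -/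
theorem above_mono_down {σ t t' : ℝ} {v w : Fin 2 → ℝ} (hs : w 1 ≤ v 1) (htt : t ≤ t')
    (h : ![σ, t'] ⬝ᵥ v < ![σ, t'] ⬝ᵥ w) : ![σ, t] ⬝ᵥ v < ![σ, t] ⬝ᵥ w := by
  have e1 := chart_sub_eq σ t v w
  have e2 := chart_sub_eq σ t' v w
  nlinarith [mul_le_mul_of_nonneg_right htt (sub_nonneg.2 hs)]

open Classical in
/-- **Threshold lemma.**  For a finite `Q`, a point `v` and any set of times `I`, the sets `{w ∈ Q : w above v at time t}` (`t ∈ I`)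
number at most `#Q + 1`: the potential `#{up-slope members} + #{down-slope non-members}` is injective on them. [folklore] -/
theorem card_thresholdSets_le (σ : ℝ) (Q : Finset (Fin 2 → ℝ)) (v : Fin 2 → ℝ) (I : Set ℝ) :
    (thresholdSets σ Q v I).card ≤ Q.card + 1 := by
  classical
  -- the above set at time `t` and the potential
  set X : ℝ → Finset (Fin 2 → ℝ) := fun t => Q.filter fun w => ![σ, t] ⬝ᵥ v < ![σ, t] ⬝ᵥ w with hX
  set φ : Finset (Fin 2 → ℝ) → ℕ := fun Y =>
    ((Q.filter fun w => v 1 < w 1) ∩ Y).card + ((Q.filter fun w => w 1 < v 1) \ Y).card with hφ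
  -- monotonicity: for `t ≤ t'` with `X t ≠ X t'` the potential strictly increases
  have hmono : ∀ t t' : ℝ, t ≤ t' → X t ≠ X t' → φ (X t) < φ (X t') := by
    intro t t' htt hne
    -- componentwise monotonicity
    have hup : (Q.filter fun w => v 1 < w 1) ∩ X t ⊆ (Q.filter fun w => v 1 < w 1) ∩ X t' := by
      intro w hw
      rw [Finset.mem_inter, Finset.mem_filter] at hw ⊢
      refine ⟨hw.1, ?_⟩
      rw [hX, Finset.mem_filter] at hw ⊢
      exact ⟨hw.2.1, above_mono_up hw.1.2.le htt hw.2.2⟩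
    have hdown : (Q.filter fun w => w 1 < v 1) \ X t ⊆ (Q.filter fun w => w 1 < v 1) \ X t' := by
      intro w hw
      rw [Finset.mem_sdiff, Finset.mem_filter] at hw ⊢
      refine ⟨hw.1, fun hw' => hw.2 ?_⟩
      rw [hX, Finset.mem_filter] at hw' ⊢
      exact ⟨hw'.1, above_mono_down hw.1.2.le htt hw'.2⟩
    -- a witness of the difference
    obtain ⟨w, hw⟩ : ∃ w, ¬ (w ∈ X t ↔ w ∈ X t') := by
      by_contra h
      push Not at h
      exact hne (Finset.ext h)
    have hwQ : w ∈ Q := by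
      by_cases h1 : w ∈ X t
      · exact (Finset.mem_filter.1 h1).1
      · have h2 : w ∈ X t' := by
          by_contra h2; exact hw ⟨fun h => absurd h h1, fun h => absurd h h2⟩
        exact (Finset.mem_filter.1 h2).1
    -- `w` is not flat
    have hslope : v 1 ≠ w 1 := by
      intro heq
      apply hw
      rw [hX, Finset.mem_filter, Finset.mem_filter]
      have e1 := chart_sub_eq σ t v w
      have e2 := chart_sub_eq σ t' v w
      rw [← heq, sub_self, mul_zero, add_zero] at e1 e2
      constructor
      · rintro ⟨hq, h⟩; exact ⟨hq, by linarith⟩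
      · rintro ⟨hq, h⟩; exact ⟨hq, by linarith⟩
    rcases lt_or_gt_of_ne hslope with hlt | hgt
    · -- up-slope: `w ∈ X t' \ X t`
      have hwt' : w ∈ X t' := by
        by_contra h2
        have h1 : w ∈ X t := by
          by_contra h1; exact hw ⟨fun h => absurd h h1, fun h => absurd h h2⟩
        exact h2 (by
          rw [hX, Finset.mem_filter] at h1 ⊢
          exact ⟨h1.1, above_mono_up hlt.le htt h1.2⟩)
      have hwt : w ∉ X t := fun h1 => hw ⟨fun _ => hwt', fun _ => h1⟩
      have hstrict : ((Q.filter fun w => v 1 < w 1) ∩ X t).card < ((Q.filter fun w => v 1 < w 1) ∩ X t').card := by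
        refine Finset.card_lt_card ⟨hup, fun hsub => hwt ?_⟩
        have : w ∈ (Q.filter fun w => v 1 < w 1) ∩ X t' :=
          Finset.mem_inter.2 ⟨Finset.mem_filter.2 ⟨hwQ, hlt⟩, hwt'⟩
        exact (Finset.mem_inter.1 (hsub this)).2
      have hweak := Finset.card_le_card hdown
      simp only [hφ]
      omega
    · -- down-slope: `w ∈ X t \ X t'`
      have hwt : w ∈ X t := by
        by_contra h1
        have h2 : w ∈ X t' := by
          by_contra h2; exact hw ⟨fun h => absurd h h1, fun h => absurd h h2⟩
        exact h1 (by
          rw [hX, Finset.mem_filter] at h2 ⊢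
          exact ⟨h2.1, above_mono_down hgt.le htt h2.2⟩)
      have hwt' : w ∉ X t' := fun h2 => hw ⟨fun _ => h2, fun _ => hwt⟩
      have hstrict : ((Q.filter fun w => w 1 < v 1) \ X t).card < ((Q.filter fun w => w 1 < v 1) \ X t').card := by
        refine Finset.card_lt_card ⟨hdown, fun hsub => hwt' ?_⟩
        have : w ∈ (Q.filter fun w => w 1 < v 1) \ X t' :=
          Finset.mem_sdiff.2 ⟨Finset.mem_filter.2 ⟨hwQ, hgt⟩, hwt'⟩
        have := (Finset.mem_sdiff.1 (hsub this)).2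
        exact absurd hwt this
      have hweak := Finset.card_le_card hup
      simp only [hφ]
      omega
  -- injectivity of the potential on the realised sets
  have hinj : Set.InjOn φ (thresholdSets σ Q v I : Set (Finset (Fin 2 → ℝ))) := by
    intro Y hY Y' hY' hφeq
    obtain ⟨-, t, -, rfl⟩ := Finset.mem_filter.1 (Finset.mem_coe.1 hY)
    obtain ⟨-, t', -, rfl⟩ := Finset.mem_filter.1 (Finset.mem_coe.1 hY')
    change φ (X t) = φ (X t') at hφeq
    change X t = X t'
    by_contra hne
    rcases le_total t t' with h | h
    · exact absurd hφeq (ne_of_lt (hmono t t' h hne))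
    · exact absurd hφeq (ne_of_gt (hmono t' t h (Ne.symm hne)))
  -- the potential is at most `#Q`
  have hmaps : Set.MapsTo φ (thresholdSets σ Q v I : Set (Finset (Fin 2 → ℝ))) (Finset.range (Q.card + 1) : Set ℕ) := by
    intro Y _
    rw [Finset.mem_coe, Finset.mem_range, Nat.lt_succ_iff]
    simp only [hφ]
    calc ((Q.filter fun w => v 1 < w 1) ∩ Y).card + ((Q.filter fun w => w 1 < v 1) \ Y).card
        ≤ (Q.filter fun w => v 1 < w 1).card + (Q.filter fun w => w 1 < v 1).card :=
          add_le_add (Finset.card_le_card Finset.inter_subset_left) (Finset.card_le_card Finset.sdiff_subset)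
      _ ≤ Q.card := by
          rw [← Finset.card_union_of_disjoint]
          · exact Finset.card_le_card (Finset.union_subset (Finset.filter_subset _ _) (Finset.filter_subset _ _))
          · rw [Finset.disjoint_filter]
            intro w _ h1 h2
            exact lt_asymm h1 h2
  calc (thresholdSets σ Q v I).card ≤ (Finset.range (Q.card + 1)).card :=
        Finset.card_le_card_of_injOn φ hmaps hinj
    _ = Q.card + 1 := Finset.card_range _

end Threshold

/-! ### Counting the depth pairs of order `≤ j` along a chart -/

section DepthPairs

variable {G : Type*} [AddCommGroup G] [Fintype G] [DecidableEq G]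

open Classical in
/-- The DEPTH PAIRS of order `≤ j` off the time set `T`: pairs `(v, F)` with `v` a sumset point and `F = aboveFib σ t v` its set of
fibres above at some time `t ∉ T`, of size `≤ j`. -/
noncomputable def depthPairs (a b : G → (Fin 2 → ℝ)) (σ : ℝ) (j : ℕ) (T : Finset ℝ) :
    Finset ((Fin 2 → ℝ) × Finset G) :=
  (sumFin a b ×ˢ (Finset.univ : Finset G).powerset).filter fun p =>
    ∃ t : ℝ, t ∉ T ∧ p.2 = aboveFib a b σ t p.1 ∧ p.2.card ≤ j

open Classical in
/-- **Depth pairs are few.**  If `T` contains every low-event time of order `< j+1` of `A = a(G)` and of `B = b(G)` (chart `σ`),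
then `#depthPairs_j(T) ≤ (#T + 1)·(j+1)²·((j+1)²+1)`: in each of the `≤ #T + 1` cells between consecutive times of `T` the set
`topSum_j` is a fixed set `Q` of `≤ (j+1)²` points, every depth pair of the cell has `v ∈ Q` and `F` determined by the above set
`{w ∈ Q : w above v}`, and these above sets number `≤ #Q + 1` per `v` (threshold lemma). [folklore] -/
theorem card_depthPairs_le (a b : G → (Fin 2 → ℝ)) {σ : ℝ} (j : ℕ) (T : Finset ℝ)
    (hTA : ∀ e : ℝ × ℝ, IsLowEvent σ (Finset.univ.image a) (j + 1) e → e.1 ∈ T)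
    (hTB : ∀ e : ℝ × ℝ, IsLowEvent σ (Finset.univ.image b) (j + 1) e → e.1 ∈ T) :
    (depthPairs a b σ j T).card ≤ (T.card + 1) * ((j + 1) ^ 2 * ((j + 1) ^ 2 + 1)) := by
  classical
  -- the depth pairs witnessed in cell `i`
  set D : ℕ → Finset ((Fin 2 → ℝ) × Finset G) := fun i => (depthPairs a b σ j T).filter fun p =>
    ∃ t : ℝ, t ∉ T ∧ cellIdx T t = i ∧ p.2 = aboveFib a b σ t p.1 ∧ p.2.card ≤ j with hD
  have hcover : depthPairs a b σ j T ⊆ (Finset.range (T.card + 1)).biUnion D := by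
    intro p hp
    obtain ⟨hp1, t, htT, hF, hcard⟩ := Finset.mem_filter.1 hp
    rw [Finset.mem_biUnion]
    refine ⟨cellIdx T t, Finset.mem_range.2 (Nat.lt_succ_of_le (cellIdx_le_card T t)), ?_⟩
    rw [hD]
    exact Finset.mem_filter.2 ⟨hp, t, htT, rfl, hF, hcard⟩
  -- each cell carries few depth pairs
  have hcell : ∀ i, (D i).card ≤ (j + 1) ^ 2 * ((j + 1) ^ 2 + 1) := by
    intro i
    by_cases hne : (D i).Nonempty
    swap
    · rw [Finset.not_nonempty_iff_eq_empty.1 hne, Finset.card_empty]; exact Nat.zero_le _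
    -- a reference time of the cell and its `topSum`
    obtain ⟨p₀, hp₀⟩ := hne
    obtain ⟨-, t₀, ht₀T, ht₀i, -, -⟩ := Finset.mem_filter.1 hp₀
    set Q := topSum a b σ j t₀ with hQ
    have hQt : ∀ t : ℝ, t ∉ T → cellIdx T t = i → topSum a b σ j t = Q := by
      intro t htT hti
      rw [hQ]
      unfold topSum
      rw [topSet_eq_of_cellIdx_eq' hTA htT ht₀T (hti.trans ht₀i.symm),
        topSet_eq_of_cellIdx_eq' hTB htT ht₀T (hti.trans ht₀i.symm)]
    have hQcard : Q.card ≤ (j + 1) ^ 2 :=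
      card_topSum_le (fun e he h => ht₀T (h ▸ hTA e he)) (fun e he h => ht₀T (h ▸ hTB e he))
    -- the cell's time set
    set I : Set ℝ := {t | t ∉ T ∧ cellIdx T t = i} with hI
    -- `D i` embeds into `Σ_{v ∈ Q} thresholdSets`
    set img : Finset ((Fin 2 → ℝ) × Finset G) := Q.biUnion fun v =>
      (thresholdSets σ Q v I).image fun X => (v, X.biUnion (fibresOf a b)) with himg
    have hsub : D i ⊆ img := by
      intro p hp
      obtain ⟨hpD, t, htT, hti, hF, hcard⟩ := Finset.mem_filter.1 hp
      obtain ⟨hp1, -⟩ := Finset.mem_filter.1 hpD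
      have hvS : p.1 ∈ sumFin a b := (Finset.mem_product.1 hp1).1
      have hdepth : (aboveFib a b σ t p.1).card ≤ j := hF ▸ hcard
      have hvQ : p.1 ∈ Q := hQt t htT hti ▸ mem_topSum_of_card_aboveFib_le hvS hdepth
      rw [himg, Finset.mem_biUnion]
      refine ⟨p.1, hvQ, ?_⟩
      rw [Finset.mem_image]
      refine ⟨Q.filter fun w => ![σ, t] ⬝ᵥ p.1 < ![σ, t] ⬝ᵥ w, ?_, ?_⟩
      · unfold thresholdSets
        exact Finset.mem_filter.2 ⟨Finset.mem_powerset.2 (Finset.filter_subset _ _), t, ⟨htT, hti⟩, rfl⟩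
      · rw [← hQt t htT hti, ← aboveFib_eq_biUnion_topSum hdepth, ← hF]
  -- count
    calc (D i).card ≤ img.card := Finset.card_le_card hsub
      _ ≤ ∑ v ∈ Q, ((thresholdSets σ Q v I).image fun X => (v, X.biUnion (fibresOf a b))).card :=
          Finset.card_biUnion_le
      _ ≤ ∑ v ∈ Q, (Q.card + 1) := Finset.sum_le_sum fun v _ =>
          Finset.card_image_le.trans (card_thresholdSets_le σ Q v I)
      _ = Q.card * (Q.card + 1) := by rw [Finset.sum_const, smul_eq_mul]
      _ ≤ (j + 1) ^ 2 * ((j + 1) ^ 2 + 1) := Nat.mul_le_mul hQcard (Nat.succ_le_succ hQcard)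
  calc (depthPairs a b σ j T).card ≤ ((Finset.range (T.card + 1)).biUnion D).card := Finset.card_le_card hcover
    _ ≤ ∑ i ∈ Finset.range (T.card + 1), (D i).card := Finset.card_biUnion_le
    _ ≤ ∑ _i ∈ Finset.range (T.card + 1), (j + 1) ^ 2 * ((j + 1) ^ 2 + 1) := Finset.sum_le_sum fun i _ => hcell i
    _ = (T.card + 1) * ((j + 1) ^ 2 * ((j + 1) ^ 2 + 1)) := by rw [Finset.sum_const, Finset.card_range, smul_eq_mul]

/-- The low-event TIMES of order `< j+1` of the two alphabets along the chart `σ`. -/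
noncomputable def lowTimes (a b : G → (Fin 2 → ℝ)) (σ : ℝ) (j : ℕ) : Finset ℝ :=
  (lowEvents σ (Finset.univ.image a) (j + 1)).image Prod.fst ∪ (lowEvents σ (Finset.univ.image b) (j + 1)).image Prod.fst

omit [AddCommGroup G] [DecidableEq G] in
/-- Every low event of order `< j+1` of `A` happens at a time of `lowTimes`. [folklore] -/
theorem fst_mem_lowTimes_left {a b : G → (Fin 2 → ℝ)} {σ : ℝ} (hσ : σ ≠ 0) {j : ℕ} (e : ℝ × ℝ)
    (he : IsLowEvent σ (Finset.univ.image a) (j + 1) e) : e.1 ∈ lowTimes a b σ j := by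
  unfold lowTimes
  exact Finset.mem_union_left _ (Finset.mem_image.2 ⟨e, (mem_lowEvents hσ).2 he, rfl⟩)

omit [AddCommGroup G] [DecidableEq G] in
/-- Every low event of order `< j+1` of `B` happens at a time of `lowTimes`. [folklore] -/
theorem fst_mem_lowTimes_right {a b : G → (Fin 2 → ℝ)} {σ : ℝ} (hσ : σ ≠ 0) {j : ℕ} (e : ℝ × ℝ)
    (he : IsLowEvent σ (Finset.univ.image b) (j + 1) e) : e.1 ∈ lowTimes a b σ j := by
  unfold lowTimes
  exact Finset.mem_union_right _ (Finset.mem_image.2 ⟨e, (mem_lowEvents hσ).2 he, rfl⟩)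

omit [AddCommGroup G] [DecidableEq G] in
/-- `#lowTimes_j ≤ 32|G|(j+1)` (Clarkson–Shor, `…ChartLevelsCount.card_lowEvents_le`). [folklore] -/
theorem card_lowTimes_le (a b : G → (Fin 2 → ℝ)) {σ : ℝ} (hσ : σ ≠ 0) (j : ℕ) :
    (lowTimes a b σ j).card ≤ 32 * Fintype.card G * (j + 1) := by
  have hA : (Finset.univ.image a : Finset (Fin 2 → ℝ)).card ≤ Fintype.card G :=
    Finset.card_image_le.trans (by rw [Finset.card_univ])
  have hB : (Finset.univ.image b : Finset (Fin 2 → ℝ)).card ≤ Fintype.card G :=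
    Finset.card_image_le.trans (by rw [Finset.card_univ])
  unfold lowTimes
  calc _ ≤ ((lowEvents σ (Finset.univ.image a) (j + 1)).image Prod.fst).card +
          ((lowEvents σ (Finset.univ.image b) (j + 1)).image Prod.fst).card := Finset.card_union_le _ _
    _ ≤ (lowEvents σ (Finset.univ.image a) (j + 1)).card + (lowEvents σ (Finset.univ.image b) (j + 1)).card :=
        add_le_add Finset.card_image_le Finset.card_image_le
    _ ≤ 16 * (Finset.univ.image a : Finset (Fin 2 → ℝ)).card * (j + 1) +
          16 * (Finset.univ.image b : Finset (Fin 2 → ℝ)).card * (j + 1) :=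
        add_le_add (card_lowEvents_le hσ _ (Nat.succ_le_succ (Nat.zero_le j)))
          (card_lowEvents_le hσ _ (Nat.succ_le_succ (Nat.zero_le j)))
    _ ≤ 16 * Fintype.card G * (j + 1) + 16 * Fintype.card G * (j + 1) := by gcongr
    _ = 32 * Fintype.card G * (j + 1) := by ring

/-- **Depth pairs are few — polynomial form**: off the `≤ 32|G|(j+1)` low-event times, the depth pairs of order `≤ j` number at most
`(32|G|(j+1) + 1)·(j+1)²·((j+1)²+1)` (any superset `T ⊇ lowTimes_j` of excluded times only shrinks the family). [folklore] -/
theorem card_depthPairs_le_poly (a b : G → (Fin 2 → ℝ)) {σ : ℝ} (hσ : σ ≠ 0) (j : ℕ) (T : Finset ℝ)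
    (hT : lowTimes a b σ j ⊆ T) :
    (depthPairs a b σ j T).card ≤ (32 * Fintype.card G * (j + 1) + 1) * ((j + 1) ^ 2 * ((j + 1) ^ 2 + 1)) := by
  classical
  -- shrinking the excluded set to `lowTimes` only enlarges the family
  have hmono : depthPairs a b σ j T ⊆ depthPairs a b σ j (lowTimes a b σ j) := by
    intro p hp
    obtain ⟨hp1, t, htT, hF, hcard⟩ := Finset.mem_filter.1 hp
    exact Finset.mem_filter.2 ⟨hp1, t, fun h => htT (hT h), hF, hcard⟩
  calc _ ≤ (depthPairs a b σ j (lowTimes a b σ j)).card := Finset.card_le_card hmono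
    _ ≤ ((lowTimes a b σ j).card + 1) * ((j + 1) ^ 2 * ((j + 1) ^ 2 + 1)) :=
        card_depthPairs_le a b j _ (fst_mem_lowTimes_left hσ) (fst_mem_lowTimes_right hσ)
    _ ≤ (32 * Fintype.card G * (j + 1) + 1) * ((j + 1) ^ 2 * ((j + 1) ^ 2 + 1)) :=
        Nat.mul_le_mul_right _ (Nat.succ_le_succ (card_lowTimes_le a b hσ j))

end DepthPairs

end TotalsLaw

end Summit.ValiantsHypothesis.ValiantsHypothesis.Theorems.NewtonUnitEquationsDissociatedUniform
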